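import Literature.MathematicalPhysics.QuantumLattice.HubbardFreePropagatorPeriodization
import HarnessLib

/-!
# The imaginary-time free Hubbard propagator on the torus is the periodization of the
infinite-volume one (every complex time separation); decay and finite-size correction

Topic `MathematicalPhysics/QuantumLattice`; continuation of `HubbardFreePropagatorPeriodization.lean`
(the equal-time case) to the imaginary-time two-point function of
`HubbardFreePropagatorLimit.lean`, `hubbardThermalTwoPointEvolved β 0 μ L x σ t y σ' s =
δ_{σσ'} L⁻² Σ_k F^{s-t}_{β,μ,y-x}(2πk/L)` with BGM's integrand
`F^τ_{β,μ,z}(p) = e^{ip·z} e^{-τ(ε(p)-μ)} f_β(ε(p)-μ)` ((1.2)–(1.4); at `τ = 0` this is the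
equal-time propagator). For every FIXED complex `τ` the symbol `p ↦ e^{-τ(ε(p)-μ)} f_β(ε(p)-μ)` is
smooth on the torus, so the argument of the equal-time file applies verbatim. PROVED:

* `hubbardFreeSymbolTime β μ τ : 𝕋^d → ℂ`, smooth (`isSmooth_hubbardFreeSymbolTime`);
* `freePropagatorInfiniteTime β μ τ z = ∫_{𝕋^d} e^{2πi t·z} e^{-τ(ε(2πt)-μ)} f_β(ε(2πt)-μ) dt` —
  BGM's free propagator `g(τ, z)` "in the limit `L → ∞`" ((2.4), the covariance of the Grassmann
  integration) as a multiple Fourier coefficient; absolutely summable over `ℤ^d` with every-order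
  decay at each fixed `τ` (`summable_norm_freePropagatorInfiniteTime`,
  `exists_decay_freePropagatorInfiniteTime`);
* **sum over images** (`hubbardThermalTwoPointEvolved_zero_interaction_eq_tsum_images`): for
  `L ≥ 3`, `⟨a⁺_{xσ}(t) a⁻_{yσ'}(s)⟩_{β,L,U=0} = δ_{σσ'} Σ_{n ∈ ℤ²} g(s - t, y - x + Ln)`;
* finite-size bound (`norm_hubbardThermalTwoPointEvolved_zero_interaction_sub_le`), the
  thermodynamic limit again (`tendsto_hubbardThermalTwoPointEvolved_zero_interaction'`) and the
  identification of `freePropagatorInfiniteTime` with the Brillouin-zone integral of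
  `HubbardFreePropagatorLimit.lean` (`freePropagatorInfiniteTime_eq_integral_brillouin`);
  `freePropagatorInfiniteTime_zero` (`τ = 0` gives `freePropagatorInfinite`).

Everything is PROVED; the definitions are `hubbardFreeSymbolTime`, `hubbardFreeSymbolTimeCM`,
`freePropagatorInfiniteTime`.

## References

* G. Benfatto, A. Giuliani, V. Mastropietro, Ann. Henri Poincaré 7 (2006) 809–898, §1
  (1.2)–(1.4), §2.1 (2.4), §2.2 footnote 1 (arXiv:cond-mat/0507686 pp. 2, 5, 8).
  [BenfattoGiulianiMastropietro2006]
* J. Glimm, A. Jaffe, *Quantum Physics*, 2nd ed. (1987), §7.3, Prop. 7.3.1. [GlimmJaffeQP1987]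
-/

noncomputable section

open Filter Complex Finset UnitAddTorus
open scoped Topology ComplexConjugate ContDiff
open Literature.Probability.LatticeModels
open Literature.Analysis.FunctionSpaces.Torus (IsSmooth)

namespace Literature.MathematicalPhysics.QuantumLattice

variable {d : ℕ}

/-! ### The time-dependent free symbol `e^{-τ(ε(p)-μ)} f_β(ε(p)-μ)` on `𝕋^d` -/

section Symbol

variable (β μ : ℝ) (τ : ℂ)

/-- **The imaginary-time free symbol on the torus** (BGM 2006, (1.4)): with the band value
`E(t) = -2 Σᵢ cos 2πtᵢ - μ` (`cos 2πtᵢ = Re e^{2πi tᵢ}`),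
`t ↦ e^{-τ E(t)} f_β(E(t))` for a complex time separation `τ`. [cite: BenfattoGiulianiMastropietro2006, eq. (1.4)] -/
def hubbardFreeSymbolTime (t : UnitAddTorus (Fin d)) : ℂ :=
  Complex.exp (-τ * (((-2 * ∑ i, (fourier 1 (t i)).re - μ : ℝ)) : ℂ)) *
    ((fermiFunction β (-2 * ∑ i, (fourier 1 (t i)).re - μ) : ℝ) : ℂ)

/-- The symbol on real coordinates. [folklore] -/
theorem hubbardFreeSymbolTime_coe (y : Fin d → ℝ) :
    hubbardFreeSymbolTime β μ τ (fun i => ((y i : ℝ) : UnitAddCircle)) =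
      Complex.exp (-τ * (((-2 * ∑ i, Real.cos (2 * Real.pi * y i) - μ : ℝ)) : ℂ)) *
        ((fermiFunction β (-2 * ∑ i, Real.cos (2 * Real.pi * y i) - μ) : ℝ) : ℂ) := by
  simp only [hubbardFreeSymbolTime, fourier_one_coe_re]

/-- At the torus momenta the symbol is the time-dependent part of BGM's integrand. [cite: BenfattoGiulianiMastropietro2006, eq. (1.4)] -/
theorem hubbardFreeSymbolTime_torusPoint {L : ℕ} (k : TorusSite d L) :
    hubbardFreeSymbolTime β μ τ (torusPoint L k) =
      Complex.exp (-τ * (((-2 * ∑ i, Real.cos (latticeMomentum L k i) - μ : ℝ)) : ℂ)) *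
        ((fermiFunction β (-2 * ∑ i, Real.cos (latticeMomentum L k i) - μ) : ℝ) : ℂ) := by
  rw [show torusPoint L k = fun i => ((((k i).val : ℝ) / L : ℝ) : UnitAddCircle) from rfl,
    hubbardFreeSymbolTime_coe]
  have h : ∀ i, 2 * Real.pi * (((k i).val : ℝ) / L) = latticeMomentum L k i := fun i => by
    simp only [latticeMomentum]; ring
  simp only [h]

/-- At `τ = 0` the time-dependent symbol is the equal-time one. [folklore] -/
theorem hubbardFreeSymbolTime_zero : hubbardFreeSymbolTime (d := d) β μ 0 = hubbardFreeSymbol β μ := by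
  funext t
  simp [hubbardFreeSymbolTime, hubbardFreeSymbol]

/-- The symbol is continuous on `𝕋^d`. [folklore] -/
theorem continuous_hubbardFreeSymbolTime : Continuous (hubbardFreeSymbolTime (d := d) β μ τ) := by
  have hband : Continuous fun t : UnitAddTorus (Fin d) => (-2 * ∑ i, (fourier 1 (t i)).re - μ : ℝ) :=
    (continuous_const.mul (continuous_finsetSum _ fun i _ =>
      Complex.continuous_re.comp ((fourier 1).continuous.comp (continuous_apply i)))).sub continuous_const
  unfold hubbardFreeSymbolTime
  exact (Complex.continuous_exp.comp (continuous_const.mul (Complex.continuous_ofReal.comp hband))).mul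
    (Complex.continuous_ofReal.comp ((continuous_fermiFunction β).comp hband))

/-- **The time-dependent free symbol is smooth on `𝕋^d`** for every fixed complex `τ`. [cite: BenfattoGiulianiMastropietro2006, §2.2] -/
theorem isSmooth_hubbardFreeSymbolTime : IsSmooth (hubbardFreeSymbolTime (d := d) β μ τ) := by
  have hlift : Literature.Analysis.FunctionSpaces.Torus.lift (hubbardFreeSymbolTime (d := d) β μ τ) =
      fun y : EuclideanSpace ℝ (Fin d) =>
        Complex.exp (-τ * (((-2 * ∑ i, Real.cos (2 * Real.pi * y i) - μ : ℝ)) : ℂ)) *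
          ((fermiFunction β (-2 * ∑ i, Real.cos (2 * Real.pi * y i) - μ) : ℝ) : ℂ) := by
    funext y
    rw [Literature.Analysis.FunctionSpaces.Torus.lift_apply]
    exact hubbardFreeSymbolTime_coe β μ τ (fun i => y i)
  unfold IsSmooth
  rw [hlift]
  have hband : ContDiff ℝ ∞ (fun y : EuclideanSpace ℝ (Fin d) => (-2 * ∑ i, Real.cos (2 * Real.pi * y i) - μ : ℝ)) := by
    refine ContDiff.sub (contDiff_const.mul (ContDiff.sum fun i _ => ?_)) contDiff_const
    exact Real.contDiff_cos.comp (contDiff_const.mul (contDiff_piLp_apply 2))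
  refine ContDiff.mul ?_ (Complex.ofRealCLM.contDiff.comp ((contDiff_fermiFunction β).comp hband))
  exact Complex.contDiff_exp.comp (contDiff_const.mul (Complex.ofRealCLM.contDiff.comp hband))

/-- The symbol as a continuous map. [folklore] -/
def hubbardFreeSymbolTimeCM : C(UnitAddTorus (Fin d), ℂ) :=
  ⟨hubbardFreeSymbolTime β μ τ, continuous_hubbardFreeSymbolTime β μ τ⟩

/-- Coercion of `hubbardFreeSymbolTimeCM`. [folklore] -/
@[simp] theorem coe_hubbardFreeSymbolTimeCM :
    ⇑(hubbardFreeSymbolTimeCM (d := d) β μ τ) = hubbardFreeSymbolTime β μ τ := rfl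

/-- The Fourier coefficients of the time-dependent symbol are absolutely summable. [folklore] -/
theorem summable_norm_mFourierCoeff_hubbardFreeSymbolTime :
    Summable fun n : Fin d → ℤ => ‖mFourierCoeff (hubbardFreeSymbolTime (d := d) β μ τ) n‖ :=
  Literature.Analysis.FluidPDE.ScalarFourier.summable_norm_mFourierCoeff (isSmooth_hubbardFreeSymbolTime β μ τ)

end Symbol

/-! ### The infinite-volume imaginary-time free propagator and its decay -/

section Infinite

variable (β μ : ℝ) (τ : ℂ)

/-- **The infinite-volume imaginary-time free propagator** `g(τ, z) = ∫_{𝕋^d} e^{2πi t·z}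
e^{-τ(ε(2πt)-μ)} f_β(ε(2πt)-μ) dt = (2π)^{-d} ∫_{[0,2π]^d} e^{ip·z} e^{-τ(ε(p)-μ)} f_β(ε(p)-μ) dp` —
BGM's free propagator (2.4) ("in the limit `L → ∞`") for `U = 0`, `0 ≤ τ < β` up to the
conventions of `HubbardFreePropagatorLimit.lean`, as the Fourier coefficient
`𝓕(hubbardFreeSymbolTime β μ τ)(-z)`. [cite: BenfattoGiulianiMastropietro2006, eq. (2.4)] -/
def freePropagatorInfiniteTime (z : Site d) : ℂ :=
  mFourierCoeff (hubbardFreeSymbolTime (d := d) β μ τ) (-z)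

/-- At `τ = 0` this is the equal-time infinite-volume propagator. [folklore] -/
theorem freePropagatorInfiniteTime_zero (z : Site d) :
    freePropagatorInfiniteTime (d := d) β μ 0 z = freePropagatorInfinite β μ z := by
  rw [freePropagatorInfiniteTime, hubbardFreeSymbolTime_zero, freePropagatorInfinite_apply]

/-- **Summable decay** of `g(τ, ·)` over `ℤ^d` at each fixed `τ`. [cite: BenfattoGiulianiMastropietro2006, §2.2] -/
theorem summable_norm_freePropagatorInfiniteTime :
    Summable fun z : Site d => ‖freePropagatorInfiniteTime (d := d) β μ τ z‖ :=
  ((summable_norm_mFourierCoeff_hubbardFreeSymbolTime β μ τ).comp_injective neg_injective :)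

/-- **Polynomial decay of every order** of `g(τ, ·)` at each fixed `τ`. [cite: BenfattoGiulianiMastropietro2006, §2.2] -/
theorem exists_decay_freePropagatorInfiniteTime (K : ℕ) :
    ∃ C : ℝ, 0 ≤ C ∧ ∀ z : Site d,
      ‖freePropagatorInfiniteTime (d := d) β μ τ z‖ ≤ C * ((1 + ‖z‖) ^ K)⁻¹ := by
  obtain ⟨C, hC0, hC⟩ := Literature.Analysis.FluidPDE.ScalarFourier.exists_hasDecay_mFourierCoeff
    (isSmooth_hubbardFreeSymbolTime (d := d) β μ τ) K
  refine ⟨C, hC0, fun z => ?_⟩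
  have := hC (-z)
  rwa [norm_neg] at this

end Infinite

/-! ### The imaginary-time torus propagator is the sum over images -/

section Images

variable (β μ : ℝ)

/-- The momentum sum of `HubbardFreePropagatorLimit` in terms of the sampled symbol. [folklore] -/
theorem sum_freePropagatorIntegrandTime_latticeMomentum {L : ℕ} [NeZero L] (τ : ℂ) (z : Site d) :
    ∑ k : TorusSite d L, freePropagatorIntegrandTime β μ τ z (latticeMomentum L k) =
      ∑ k : TorusSite d L, hubbardFreeSymbolTime β μ τ (torusPoint L k) * torusChar k (Torus.proj L z) := by
  refine Finset.sum_congr rfl fun k _ => ?_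
  rw [freePropagatorIntegrandTime, torusChar_proj, hubbardFreeSymbolTime_torusPoint, mul_comm]

/-- **The imaginary-time free torus propagator is the periodization of the infinite-volume one**:
for `L ≥ 3` and complex times `t, s`,
`⟨a⁺_{xσ}(t) a⁻_{yσ'}(s)⟩_{β,L,U=0} = δ_{σσ'} Σ_{n ∈ ℤ²} g(s - t, y - x + Ln)`. [cite: BenfattoGiulianiMastropietro2006, eq. (1.4)] -/
theorem hubbardThermalTwoPointEvolved_zero_interaction_eq_tsum_images {L : ℕ} (hL : 3 ≤ L)
    (x y : Site 2) (σ σ' : Fin 2) (t s : ℂ) :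
    hubbardThermalTwoPointEvolved β 0 μ L x σ t y σ' s =
      if σ = σ' then ∑' n : Site 2, freePropagatorInfiniteTime β μ (s - t) (y - x + (L : ℤ) • n) else 0 := by
  haveI : NeZero L := ⟨by omega⟩
  rw [hubbardThermalTwoPointEvolved_zero_interaction_eq_sum hL]
  split_ifs with h
  · rw [sum_freePropagatorIntegrandTime_latticeMomentum, ← torusFourierInv_eq_sum_torusChar]
    have := torusFourierInv_apply_torusPoint_eq_tsum (L := L) (hubbardFreeSymbolTimeCM β μ (s - t))
      (summable_norm_mFourierCoeff_hubbardFreeSymbolTime β μ (s - t)) (y - x)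
    simp only [coe_hubbardFreeSymbolTimeCM] at this
    rw [this]
    rfl
  · rfl

/-- **Finite-size correction** at unequal times: for `L ≥ 3` and `R + 1 + Σᵢ|(y-x)ᵢ| ≤ L`,
`|⟨a⁺_{xσ}(t) a⁻_{yσ}(s)⟩_{β,L,U=0} - g(s-t, y-x)| ≤ Σ_{w ∉ {-R..R}²} |g(s-t, w)|`. [cite: BenfattoGiulianiMastropietro2006, §2.2] -/
theorem norm_hubbardThermalTwoPointEvolved_zero_interaction_sub_le {L R : ℕ} (hL : 3 ≤ L) (x y : Site 2)
    (σ : Fin 2) (t s : ℂ) (hR : (R : ℤ) + 1 + ∑ i, |(y - x) i| ≤ L) :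
    ‖hubbardThermalTwoPointEvolved β 0 μ L x σ t y σ s - freePropagatorInfiniteTime β μ (s - t) (y - x)‖ ≤
      ∑' w : {w // w ∉ box 2 R}, ‖freePropagatorInfiniteTime β μ (s - t) (w : Site 2)‖ := by
  rw [hubbardThermalTwoPointEvolved_zero_interaction_eq_tsum_images β μ hL, if_pos rfl]
  exact norm_tsum_translate_sub_le (summable_norm_freePropagatorInfiniteTime β μ (s - t)) (by omega) (y - x) hR

/-- **Thermodynamic limit at unequal times, by periodization.** [cite: BenfattoGiulianiMastropietro2006, eq. (2.4)] -/
theorem tendsto_hubbardThermalTwoPointEvolved_zero_interaction' (x y : Site 2) (σ σ' : Fin 2) (t s : ℂ) :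
    Tendsto (fun L : ℕ => hubbardThermalTwoPointEvolved β 0 μ L x σ t y σ' s) atTop
      (𝓝 (if σ = σ' then freePropagatorInfiniteTime β μ (s - t) (y - x) else 0)) := by
  have hev : (fun L : ℕ => hubbardThermalTwoPointEvolved β 0 μ L x σ t y σ' s) =ᶠ[atTop]
      fun L => if σ = σ' then ∑' n : Site 2, freePropagatorInfiniteTime β μ (s - t) (y - x + (L : ℤ) • n) else 0 :=
    (eventually_ge_atTop 3).mono fun L hL =>
      hubbardThermalTwoPointEvolved_zero_interaction_eq_tsum_images β μ hL x y σ σ' t s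
  rw [tendsto_congr' hev]
  split_ifs
  · exact tendsto_tsum_translate (summable_norm_freePropagatorInfiniteTime β μ (s - t)) (y - x)
  · exact tendsto_const_nhds

/-- **Identification with the Brillouin-zone integral** of `HubbardFreePropagatorLimit.lean`:
`g(τ, z) = (2π)⁻² ∫_{[-π,π)²} F^τ_{β,μ,z}(q + π) dq` for every complex `τ` and `z ∈ ℤ²`. [cite: BenfattoGiulianiMastropietro2006, eq. (2.4)] -/
theorem freePropagatorInfiniteTime_eq_integral_brillouin (τ : ℂ) (z : Site 2) :
    freePropagatorInfiniteTime β μ τ z =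
      (((2 * Real.pi) ^ 2 : ℝ) : ℂ)⁻¹ *
        ∫ q in brillouin 2, freePropagatorIntegrandTime β μ τ z (q + fun _ => Real.pi) := by
  have h1 := tendsto_hubbardThermalTwoPointEvolved_zero_interaction' β μ 0 z 0 0 0 τ
  have h2 := tendsto_hubbardThermalTwoPointEvolved_zero_interaction β μ 0 z 0 0 0 τ
  simp only [if_true, sub_zero] at h1 h2
  exact tendsto_nhds_unique h1 h2

end Images

end Literature.MathematicalPhysics.QuantumLattice

end
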